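import Mathlib
import Literature.Analysis.FluidPDE.TypeIICoreWitness
import Literature.Analysis.FluidPDE.VectorCalculus
import Literature.Analysis.FunctionSpaces.TorusPlanarLift
import Literature.Analysis.FunctionSpaces.TorusPlantingTools
import Summits.NavierStokesRegularity.NavierStokesRegularity.Theorems.TypeIIInviscidRelaxationColumnarCoreExclusionStreamFunction
import HarnessLib

/-!
# Crux `ColumnarCoreExclusion` (stmt-NavierStokesRegularity-1966), line `columnar_comparison_flow`:
# planting the columnar comparison datum on the two-torus

`--supports stmt-NavierStokesRegularity-1966` (helper file; theorems only, no definitions, no `sorry`).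

From a smooth, divergence-free field `g` on `ℝ³` that is COLUMNAR (`g (Y + a e_z) = g Y`) and vanishes outside
the solid cylinder `Y₀² + Y₁² ≤ ρ²` (the frame form of the datum `exists_compact_divFree_columnar_datum`), the
planar cut `z ↦ g (z₀, z₁, 0)`, rescaled by `ℓ = 4ρ` and centred at the cube centre `q = (½, ½)`, is supported in
the closed disc of radius `¼` about `q` (inside the open unit square); its horizontal part has zero planar
divergence (`div g = 0` and `∂_z g = 0`).  Periodising (tree: `Torus.periodize`, `isSmooth_periodize`,
`isDivFree_periodize_of_cube`) gives smooth torus data `V₀ : 𝕋² → ℝ²` (divergence free) and `R₀ : 𝕋² → ℝ` whose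
`2½`-dimensional field `(V₀, R₀) ∘ π`, read at `(q, 0) + ℓ⁻¹ Y`, is `ℓ • g Y` whenever `‖(Y₀, Y₁)‖ < ℓ/2`
(`exists_planted_torus_data`).  Nothing here says anything about Navier–Stokes regularity.
-/

noncomputable section

open Set Metric MeasureTheory Function
open Literature.Analysis Literature.Analysis.FunctionSpaces Literature.Analysis.FluidPDE
open Literature.Analysis.FunctionSpaces.Torus (twoHalf planarProj planarProjE planarEmbed twoHalf_apply_two
  twoHalf_apply_castSucc lift proj periodize perSum unitCube)
open scoped InnerProductSpace ContDiff

namespace Summit.NavierStokesRegularity.NavierStokesRegularity.Theorems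

-- the problem directory repeats the summit name (`NavierStokesRegularity/NavierStokesRegularity`)
set_option linter.dupNamespace false

namespace ColumnarComparisonPlanting

open ColumnarComparisonDatum (divergence_eq_sum_three fderiv_eZ_eq_zero_of_columnar)

/-! ## §1 The planar embedding `ℝ² × ℝ → ℝ³` and the projection `ℝ³ → ℝ²` -/

/-- `(πE w, w₂)` re-embeds to `w`. [folklore] -/
theorem planarEmbed_planarProjE (w : EuclideanSpace ℝ (Fin 3)) : planarEmbed (planarProjE w, w 2) = w := by
  ext i
  fin_cases i
  · simp
  · simp
  · exact Torus.planarEmbed_apply_two _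

/-- The horizontal part of `Y` re-embedded at height `0` is `Y` translated vertically: `(πE Y, 0) = Y + (−Y₂) • e_z`.
[folklore] -/
theorem planarEmbed_planarProjE_zero (Y : EuclideanSpace ℝ (Fin 3)) :
    planarEmbed (planarProjE Y, 0) = Y + (-(Y 2)) • eZ := by
  ext i
  fin_cases i
  · simp [eZ]
  · simp [eZ]
  · show planarEmbed (planarProjE Y, 0) 2 = (Y + (-(Y 2)) • eZ) 2
    rw [Torus.planarEmbed_apply_two]
    simp [eZ]

/-- A columnar field only sees the horizontal part: `g (πE Y, 0) = g Y`. [folklore] -/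
theorem apply_planarEmbed_planarProjE {α : Type*} {g : EuclideanSpace ℝ (Fin 3) → α} (hcol : IsColumnar g)
    (Y : EuclideanSpace ℝ (Fin 3)) : g (planarEmbed (planarProjE Y, 0)) = g Y := by
  rw [planarEmbed_planarProjE_zero]
  exact hcol Y _

/-- The embedded planar basis vectors are the first two basis vectors of `ℝ³`. [folklore] -/
theorem planarEmbed_single_zero (j : Fin 2) :
    planarEmbed (EuclideanSpace.single j (1 : ℝ), 0) = EuclideanSpace.single (Fin.castSucc j) 1 := by
  ext i
  fin_cases i <;> fin_cases j <;> simp [Torus.planarEmbed_apply_two]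

/-- Squared norm of the horizontal part: `‖πE Y‖² = Y₀² + Y₁²`. [folklore] -/
theorem norm_sq_planarProjE (Y : EuclideanSpace ℝ (Fin 3)) : ‖planarProjE Y‖ ^ 2 = Y 0 ^ 2 + Y 1 ^ 2 := by
  rw [EuclideanSpace.real_norm_sq_eq, Fin.sum_univ_two]
  simp

/-! ## §2 The rescaled planar cut of a columnar field -/

section Cut

variable {g : EuclideanSpace ℝ (Fin 3) → EuclideanSpace ℝ (Fin 3)} {ρ ℓ : ℝ} {q : EuclideanSpace ℝ (Fin 2)}
  {G₂ : EuclideanSpace ℝ (Fin 2) → EuclideanSpace ℝ (Fin 2)} {G₃ : EuclideanSpace ℝ (Fin 2) → ℝ}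

/-- The affine planar-to-space chart `z ↦ (ℓ(z − q), 0)` is smooth. [folklore] -/
theorem contDiff_chart (ℓ : ℝ) (q : EuclideanSpace ℝ (Fin 2)) :
    ContDiff ℝ ∞ (fun z : EuclideanSpace ℝ (Fin 2) => planarEmbed (ℓ • (z - q), (0 : ℝ))) :=
  planarEmbed.contDiff.comp (((contDiff_id.sub contDiff_const).const_smul ℓ).prodMk contDiff_const)

/-- The affine chart has derivative `w ↦ (ℓ w, 0)`. [folklore] -/
theorem hasFDerivAt_chart (ℓ : ℝ) (q z : EuclideanSpace ℝ (Fin 2)) :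
    HasFDerivAt (fun z : EuclideanSpace ℝ (Fin 2) => planarEmbed (ℓ • (z - q), (0 : ℝ)))
      (planarEmbed.comp (ℓ • ContinuousLinearMap.inl ℝ (EuclideanSpace ℝ (Fin 2)) ℝ)) z := by
  have h1 : HasFDerivAt (fun z : EuclideanSpace ℝ (Fin 2) => ℓ • (z - q))
      (ℓ • ContinuousLinearMap.id ℝ (EuclideanSpace ℝ (Fin 2))) z :=
    ((hasFDerivAt_id z).sub_const q).const_smul ℓ
  have h2 : HasFDerivAt (fun z : EuclideanSpace ℝ (Fin 2) => (ℓ • (z - q), (0 : ℝ)))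
      ((ℓ • ContinuousLinearMap.id ℝ (EuclideanSpace ℝ (Fin 2))).prod 0) z :=
    h1.prodMk (hasFDerivAt_const (0 : ℝ) z)
  have h3 := planarEmbed.hasFDerivAt.comp z h2
  have e : planarEmbed.comp (ℓ • ContinuousLinearMap.inl ℝ (EuclideanSpace ℝ (Fin 2)) ℝ) =
      planarEmbed.comp ((ℓ • ContinuousLinearMap.id ℝ (EuclideanSpace ℝ (Fin 2))).prod 0) := by
    ext1 w
    simp [← map_smul, Prod.smul_mk]
  rw [e]
  exact h3

/-- The rescaled horizontal cut `G₂ z = ℓ • πE (g (ℓ(z − q), 0))` is smooth. [folklore] -/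
theorem contDiff_cutH (hg : ContDiff ℝ ∞ g)
    (hG₂ : G₂ = fun z => ℓ • planarProjE (g (planarEmbed (ℓ • (z - q), (0 : ℝ))))) : ContDiff ℝ ∞ G₂ := by
  rw [hG₂]
  exact (planarProjE.contDiff.comp (hg.comp (contDiff_chart ℓ q))).const_smul ℓ

/-- The rescaled vertical cut `G₃ z = ℓ · (g (ℓ(z − q), 0))₂` is smooth. [folklore] -/
theorem contDiff_cutV (hg : ContDiff ℝ ∞ g)
    (hG₃ : G₃ = fun z => ℓ * (g (planarEmbed (ℓ • (z - q), (0 : ℝ)))) 2) : ContDiff ℝ ∞ G₃ := by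
  rw [hG₃]
  have h2 : ContDiff ℝ ∞ (fun w : EuclideanSpace ℝ (Fin 3) => w 2) :=
    (EuclideanSpace.proj (2 : Fin 3) : EuclideanSpace ℝ (Fin 3) →L[ℝ] ℝ).contDiff
  exact contDiff_const.mul (h2.comp (hg.comp (contDiff_chart ℓ q)))

/-- Off the closed disc of radius `ρ/ℓ` about `q` the chart lands outside the cylinder `Y₀² + Y₁² ≤ ρ²`, where `g`
vanishes (`ℓ > 0`). [folklore] -/
theorem apply_chart_eq_zero (hℓ : 0 < ℓ) (hρ : 0 ≤ ρ)
    (h0 : ∀ Y : EuclideanSpace ℝ (Fin 3), ρ ^ 2 < Y 0 ^ 2 + Y 1 ^ 2 → g Y = 0)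
    {z : EuclideanSpace ℝ (Fin 2)} (hz : ρ / ℓ < ‖z - q‖) :
    g (planarEmbed (ℓ • (z - q), (0 : ℝ))) = 0 := by
  apply h0
  have e : (planarEmbed (ℓ • (z - q), (0 : ℝ))) 0 ^ 2 + (planarEmbed (ℓ • (z - q), (0 : ℝ))) 1 ^ 2 =
      ‖ℓ • (z - q)‖ ^ 2 := by
    rw [EuclideanSpace.real_norm_sq_eq, Fin.sum_univ_two]
    simp
  rw [e, norm_smul, Real.norm_eq_abs, abs_of_pos hℓ, mul_pow]
  have h1 : ρ < ℓ * ‖z - q‖ := by rwa [div_lt_iff₀' hℓ] at hz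
  have h2 : ρ ^ 2 < (ℓ * ‖z - q‖) ^ 2 := pow_lt_pow_left₀ h1 hρ two_ne_zero
  rwa [mul_pow] at h2

/-- The rescaled cuts vanish off the closed disc `closedBall q (ρ/ℓ)`. [folklore] -/
theorem cut_eq_zero (hℓ : 0 < ℓ) (hρ : 0 ≤ ρ)
    (h0 : ∀ Y : EuclideanSpace ℝ (Fin 3), ρ ^ 2 < Y 0 ^ 2 + Y 1 ^ 2 → g Y = 0)
    (hG₂ : G₂ = fun z => ℓ • planarProjE (g (planarEmbed (ℓ • (z - q), (0 : ℝ)))))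
    (hG₃ : G₃ = fun z => ℓ * (g (planarEmbed (ℓ • (z - q), (0 : ℝ)))) 2)
    {z : EuclideanSpace ℝ (Fin 2)} (hz : z ∉ closedBall q (ρ / ℓ)) : G₂ z = 0 ∧ G₃ z = 0 := by
  rw [mem_closedBall, dist_eq_norm, not_le] at hz
  rw [hG₂, hG₃]
  simp [apply_chart_eq_zero hℓ hρ h0 hz]

/-- The topological supports of the rescaled cuts lie in `closedBall q (ρ/ℓ)`, hence in a ball about the origin.
[folklore] -/
theorem tsupport_cut_subset (hℓ : 0 < ℓ) (hρ : 0 ≤ ρ)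
    (h0 : ∀ Y : EuclideanSpace ℝ (Fin 3), ρ ^ 2 < Y 0 ^ 2 + Y 1 ^ 2 → g Y = 0)
    (hG₂ : G₂ = fun z => ℓ • planarProjE (g (planarEmbed (ℓ • (z - q), (0 : ℝ)))))
    (hG₃ : G₃ = fun z => ℓ * (g (planarEmbed (ℓ • (z - q), (0 : ℝ)))) 2) :
    tsupport G₂ ⊆ closedBall 0 (ρ / ℓ + ‖q‖) ∧ tsupport G₃ ⊆ closedBall 0 (ρ / ℓ + ‖q‖) := by
  have hsub : closedBall q (ρ / ℓ) ⊆ closedBall (0 : EuclideanSpace ℝ (Fin 2)) (ρ / ℓ + ‖q‖) := by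
    intro z hz
    rw [mem_closedBall, dist_eq_norm] at hz
    rw [mem_closedBall, dist_zero_right]
    calc ‖z‖ = ‖(z - q) + q‖ := by rw [sub_add_cancel]
      _ ≤ ‖z - q‖ + ‖q‖ := norm_add_le _ _
      _ ≤ ρ / ℓ + ‖q‖ := by linarith
  constructor
  · refine (closure_minimal (fun z hz => ?_) isClosed_closedBall).trans hsub
    by_contra hc
    exact hz (cut_eq_zero hℓ hρ h0 hG₂ hG₃ hc).1
  · refine (closure_minimal (fun z hz => ?_) isClosed_closedBall).trans hsub
    by_contra hc
    exact hz (cut_eq_zero hℓ hρ h0 hG₂ hG₃ hc).2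

/-- **Zero planar divergence of the horizontal cut**: `tr D G₂ (z) = ℓ² ((Dg e₀)₀ + (Dg e₁)₁) = ℓ² (div g − (Dg e_z)₂) = 0`
for a `C¹` divergence-free columnar `g`. [folklore] -/
theorem trace_fderiv_cutH (hg : ContDiff ℝ ∞ g) (hdiv : VectorCalculus.IsDivFree g) (hcol : IsColumnar g)
    (hG₂ : G₂ = fun z => ℓ • planarProjE (g (planarEmbed (ℓ • (z - q), (0 : ℝ)))))
    (z : EuclideanSpace ℝ (Fin 2)) :
    LinearMap.trace ℝ (EuclideanSpace ℝ (Fin 2))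
      (fderiv ℝ G₂ z : EuclideanSpace ℝ (Fin 2) →ₗ[ℝ] EuclideanSpace ℝ (Fin 2)) = 0 := by
  have hgd : Differentiable ℝ g := hg.differentiable (by simp)
  set P : EuclideanSpace ℝ (Fin 3) := planarEmbed (ℓ • (z - q), (0 : ℝ)) with hP
  -- the derivative of `G₂`
  have hD : HasFDerivAt G₂
      (ℓ • (planarProjE.comp ((fderiv ℝ g P).comp
        (planarEmbed.comp (ℓ • ContinuousLinearMap.inl ℝ (EuclideanSpace ℝ (Fin 2)) ℝ))))) z := by
    rw [hG₂]
    have h1 := (hgd P).hasFDerivAt.comp z (hasFDerivAt_chart ℓ q z)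
    exact (planarProjE.hasFDerivAt.comp z h1).const_smul ℓ
  change VectorCalculus.divergence G₂ z = 0
  rw [divergence_eq_sum_inner_fderiv (EuclideanSpace.basisFun (Fin 2) ℝ), Fin.sum_univ_two, hD.fderiv]
  have key : ∀ j : Fin 2, ⟪(EuclideanSpace.basisFun (Fin 2) ℝ) j,
      (ℓ • (planarProjE.comp ((fderiv ℝ g P).comp
        (planarEmbed.comp (ℓ • ContinuousLinearMap.inl ℝ (EuclideanSpace ℝ (Fin 2)) ℝ)))))
        ((EuclideanSpace.basisFun (Fin 2) ℝ) j)⟫_ℝ =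
      ℓ * ℓ * fderiv ℝ g P (EuclideanSpace.single (Fin.castSucc j) 1) (Fin.castSucc j) := by
    intro j
    rw [EuclideanSpace.basisFun_apply, EuclideanSpace.inner_single_left]
    simp only [FunLike.coe_smul, Pi.smul_apply, ContinuousLinearMap.comp_apply, ContinuousLinearMap.inl_apply,
      map_smul, PiLp.smul_apply, smul_eq_mul, Torus.planarProjE_apply]
    rw [show ((EuclideanSpace.single j (1 : ℝ), (0 : ℝ)) : EuclideanSpace ℝ (Fin 2) × ℝ) =
      (EuclideanSpace.single j (1 : ℝ), 0) from rfl, planarEmbed_single_zero]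
    simp; ring
  rw [key 0, key 1]
  have h3 := hdiv P
  rw [divergence_eq_sum_three, fderiv_eZ_eq_zero_of_columnar hgd hcol P] at h3
  have e0 : (Fin.castSucc (0 : Fin 2) : Fin 3) = 0 := rfl
  have e1 : (Fin.castSucc (1 : Fin 2) : Fin 3) = 1 := rfl
  rw [e0, e1]
  simp only [PiLp.zero_apply, add_zero] at h3
  calc ℓ * ℓ * fderiv ℝ g P (EuclideanSpace.single 0 1) 0 + ℓ * ℓ * fderiv ℝ g P (EuclideanSpace.single 1 1) 1
      = ℓ * ℓ * (fderiv ℝ g P (EuclideanSpace.single 0 1) 0 + fderiv ℝ g P (EuclideanSpace.single 1 1) 1) := by ring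
    _ = 0 := by rw [h3, mul_zero]

end Cut

/-! ## §3 Planting on the torus -/

/-- **Planted torus data of a compactly supported columnar field.**  Let `g : ℝ³ → ℝ³` be smooth, divergence free,
columnar, vanishing outside the cylinder `Y₀² + Y₁² ≤ ρ²` (`ρ > 0`), let `ℓ = 4ρ` and let `q = (½, ½)` be the centre
of the unit square.  Then there are smooth `V₀ : 𝕋² → ℝ²`, divergence free, and `R₀ : 𝕋² → ℝ` such that the
`2½`-dimensional field `(V₀, R₀) ∘ π` read at the point of `ℝ³` over `(q, 0) + ℓ⁻¹ Y` equals `ℓ • g Y` whenever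
`‖(Y₀, Y₁)‖ < ℓ/2` (periodisation of the rescaled planar cut; one lattice term on the fundamental square). [folklore] -/
theorem exists_planted_torus_data {g : EuclideanSpace ℝ (Fin 3) → EuclideanSpace ℝ (Fin 3)}
    (hg : ContDiff ℝ ∞ g) (hdiv : VectorCalculus.IsDivFree g) (hcol : IsColumnar g) {ρ : ℝ} (hρ : 0 < ρ)
    (h0 : ∀ Y : EuclideanSpace ℝ (Fin 3), ρ ^ 2 < Y 0 ^ 2 + Y 1 ^ 2 → g Y = 0)
    {q : EuclideanSpace ℝ (Fin 2)} (hq : ∀ i, q i = 1 / 2) :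
    ∃ (V₀ : UnitAddTorus (Fin 2) → EuclideanSpace ℝ (Fin 2)) (R₀ : UnitAddTorus (Fin 2) → ℝ),
      Torus.IsSmooth V₀ ∧ Torus.IsDivFree V₀ ∧ Torus.IsSmooth R₀ ∧
      ∀ Y : EuclideanSpace ℝ (Fin 3), ‖planarProjE Y‖ < 4 * ρ / 2 →
        twoHalf V₀ R₀ (proj (planarEmbed (q, (0 : ℝ)) + (4 * ρ)⁻¹ • Y)) = (4 * ρ) • g Y := by
  set ℓ : ℝ := 4 * ρ with hℓ_def
  have hℓ : 0 < ℓ := by positivity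
  obtain ⟨G₂, hG₂⟩ : ∃ G₂ : EuclideanSpace ℝ (Fin 2) → EuclideanSpace ℝ (Fin 2),
      G₂ = fun z => ℓ • planarProjE (g (planarEmbed (ℓ • (z - q), (0 : ℝ)))) := ⟨_, rfl⟩
  obtain ⟨G₃, hG₃⟩ : ∃ G₃ : EuclideanSpace ℝ (Fin 2) → ℝ,
      G₃ = fun z => ℓ * (g (planarEmbed (ℓ • (z - q), (0 : ℝ)))) 2 := ⟨_, rfl⟩
  have hρℓ : ρ / ℓ = 1 / 4 := by
    rw [hℓ_def, div_eq_iff (by positivity)]; ring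
  have hs2 : ContDiff ℝ ∞ G₂ := contDiff_cutH hg hG₂
  have hs3 : ContDiff ℝ ∞ G₃ := contDiff_cutV hg hG₃
  obtain ⟨ht2, ht3⟩ := tsupport_cut_subset hℓ hρ.le h0 hG₂ hG₃
  -- the closed disc `closedBall q (1/4)` sits inside the open unit square
  have hKsub : closedBall q (ρ / ℓ) ⊆ {y : EuclideanSpace ℝ (Fin 2) | ∀ i, y i ∈ Ioo (0 : ℝ) 1} := by
    intro z hz i
    rw [mem_closedBall, dist_eq_norm, hρℓ] at hz
    have e : z = q + (z - q) := by abel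
    rw [e]
    exact (Torus.add_mem_unitCube_of_norm_lt hq (by linarith)).2 i
  have hzero2 : ∀ y ∉ closedBall q (ρ / ℓ), G₂ y = 0 := fun y hy => (cut_eq_zero hℓ hρ.le h0 hG₂ hG₃ hy).1
  have hzero3 : ∀ y ∉ closedBall q (ρ / ℓ), G₃ y = 0 := fun y hy => (cut_eq_zero hℓ hρ.le h0 hG₂ hG₃ hy).2
  have hcube2 : ∀ y : EuclideanSpace ℝ (Fin 2), (¬ ∀ i, y i ∈ Ioo (0 : ℝ) 1) → G₂ y = 0 :=
    fun y hy => hzero2 y fun hc => hy (hKsub hc)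
  have hcube3 : ∀ y : EuclideanSpace ℝ (Fin 2), (¬ ∀ i, y i ∈ Ioo (0 : ℝ) 1) → G₃ y = 0 :=
    fun y hy => hzero3 y fun hc => hy (hKsub hc)
  refine ⟨periodize G₂, periodize G₃, Torus.isSmooth_periodize hs2 ht2,
    Torus.isDivFree_periodize_of_cube hs2 isClosed_closedBall hKsub hzero2 (trace_fderiv_cutH hg hdiv hcol hG₂),
    Torus.isSmooth_periodize hs3 ht3, fun Y hY => ?_⟩
  -- identification on the fundamental square
  have hproj : planarProjE (planarEmbed (q, (0 : ℝ)) + ℓ⁻¹ • Y) = q + ℓ⁻¹ • planarProjE Y := by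
    rw [map_add, map_smul, Torus.planarProjE_planarEmbed]
  have hmem : q + ℓ⁻¹ • planarProjE Y ∈ unitCube (Fin 2) := by
    refine (Torus.add_mem_unitCube_of_norm_lt hq ?_).1
    rw [norm_smul, Real.norm_eq_abs, abs_of_pos (inv_pos.2 hℓ)]
    rw [lt_div_iff₀ (by norm_num : (0:ℝ) < 2)] at hY
    calc ℓ⁻¹ * ‖planarProjE Y‖ < ℓ⁻¹ * (ℓ / 2) := by
          refine mul_lt_mul_of_pos_left ?_ (inv_pos.2 hℓ); linarith
      _ = 1 / 2 := by field_simp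
  have hchart : planarEmbed (ℓ • (q + ℓ⁻¹ • planarProjE Y - q), (0 : ℝ)) = planarEmbed (planarProjE Y, 0) := by
    congr 1
    rw [add_sub_cancel_left, smul_smul, mul_inv_cancel₀ hℓ.ne', one_smul]
  have hV : periodize G₂ (proj (q + ℓ⁻¹ • planarProjE Y)) = ℓ • planarProjE (g Y) := by
    rw [Torus.periodize_proj, Torus.perSum_eq_self_of_mem_unitCube hcube2 hmem, hG₂]
    show ℓ • planarProjE (g (planarEmbed (ℓ • (q + ℓ⁻¹ • planarProjE Y - q), (0 : ℝ)))) = _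
    rw [hchart, apply_planarEmbed_planarProjE hcol]
  have hR : periodize G₃ (proj (q + ℓ⁻¹ • planarProjE Y)) = ℓ * (g Y) 2 := by
    rw [Torus.periodize_proj, Torus.perSum_eq_self_of_mem_unitCube hcube3 hmem, hG₃]
    show ℓ * (g (planarEmbed (ℓ • (q + ℓ⁻¹ • planarProjE Y - q), (0 : ℝ)))) 2 = _
    rw [hchart, apply_planarEmbed_planarProjE hcol]
  rw [Torus.twoHalf_eq_comp, Function.comp_apply, Torus.planarProj_proj, hproj, hV, hR]
  calc planarEmbed (ℓ • planarProjE (g Y), ℓ * g Y 2)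
      = planarEmbed (ℓ • (planarProjE (g Y), g Y 2)) := by rw [Prod.smul_mk, smul_eq_mul]
    _ = ℓ • planarEmbed (planarProjE (g Y), g Y 2) := map_smul _ _ _
    _ = ℓ • g Y := by rw [planarEmbed_planarProjE]

end ColumnarComparisonPlanting

end Summit.NavierStokesRegularity.NavierStokesRegularity.Theorems

end
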